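import Mathlib.FieldTheory.KrullTopology
import Mathlib.FieldTheory.IsAlgClosed.AlgebraicClosure
import Mathlib.FieldTheory.IsSepClosed
import Mathlib.FieldTheory.Galois.Profinite
import Mathlib.FieldTheory.AbsoluteGaloisGroup
import Mathlib.GroupTheory.GroupAction.SubMulAction
import Literature.IUT.HodgeTheaters.KappaCoricGaloisInvariantsProofs
import Literature.IUT.HodgeTheaters.GlobalFrobenioidsKummer
import HarnessLib

/-!
# [IUTchI] Example 5.1 (i)/(v) at print's MODEL presentation: the rational Galois layer `Λ_L ⊇ L(t)`,
# `G_L^{rat} = Gal(Λ_L / L(t))`, and the `∞κ`-coric pseudo-monoid `G_L^{rat} ↷ 𝕄_{∞κ}` as a genuine `CoricPair`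

S. Mochizuki, *Inter-universal Teichmüller theory I*, kurims manuscript (May 2020): §3 Remark 3.1.7 (i), (ii)
pp. 66–67 (`κ`-, `∞κ`-, `∞κ×`-coric rational functions on `C_L`, "an element `f ∈ L̄_C` is `∞κ`-coric if there
exists a positive integer `n` such that `fⁿ` is a `κ`-coric element of `L_C`"); §5 Example 5.1 (i) pp. 123–124
("`π₁^{rat}(†𝒟^⊛) ↠ π₁(†𝒟^⊛)` … the absolute Galois group of the function field of `C_{F_mod}`", "natural
isomorphs … `𝕄^⊛_∞κ(†𝒟^⊚)`, `𝕄^⊛_∞κ×(†𝒟^⊚)` of the pseudo-monoids of `∞κ`- and `∞κ×`-coric rational functions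
associated to `C_{F_mod}` … equipped with natural `π₁^{rat}(†𝒟^⊛)`-actions", "`𝕄^⊛_κ(†𝒟^⊚)` may be identified
with the subset of `π₁^{rat}(†𝒟^⊛)`-invariants of `𝕄^⊛_∞κ(†𝒟^⊚)`"); Example 5.1 (v) p. 127 ("a pair consisting
of a pseudo-monoid equipped with a continuous action by `π₁^{rat}(†𝒟^⊛)`"); Definition 5.2 (v)–(viii)
pp. 135–142 (the local analogues `π₁^{rat}(‡𝒟_v) ↷ ‡𝕄_{∞κv} ⊆ ‡𝕄_{∞κ×v}` at a completion `L = K_v`); consumed by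
Example 5.4 (iv) p. 149 (the `∞κ`-compatibility clause, typed as `BaseThetaDatum.S5Local.InfKappaLink` /
`Ex54ivInfKappaCompat`, ★ p510882/★ p513361) ([IUTchI] Ex 5.1 (i) p.124, (v) p.127) [claim: Mochizuki2012,
status: disputed] (D-0012 claim key — the content of THIS file is elementary field theory at the MODEL; nothing
disputed is involved and no side is taken on [IUTchIII] Cor. 3.12).

## What this file builds (cell abc-iut, gap B = G-L5t9g8-1, item GB-01 = row D1 of GAP-SIZING-B.md
2de24246389ab103; acceptance standard RULINGS #315 (2) / #316 (i) of abc-iut-L5-lead: «C1 … Λ_L :=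
AlgebraicClosure (RatFunc L), G_L^rat := Λ_L ≃ₐ[RatFunc L] Λ_L, ∞κ-coric sets via L5-t2 `IsInftyKappaCoricIn` …
lands as PROVED CONTENT AT PRINT'S MODEL PRESENTATION … booked count-neutral»)

For a field `L` of characteristic `0` (print: `L = F_mod`, `F̄`, or a completion `K_v`; the divisor-counting field
`Ω` of abc-iut-L5-t2's `CriticalLocus Ω` is taken EQUAL to `L` — choose `L` algebraically closed for geometric
divisors, GAP-SIZING-B.md R1/R4): `RatAlgClosure L` = `Λ_L :=` Mathlib's `AlgebraicClosure (RatFunc L)`;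
`RatGal L` = `G_L^{rat} := Λ_L ≃ₐ[RatFunc L] Λ_L` with Mathlib's Krull topology, DEFINITIONALLY Mathlib's
`Field.absoluteGaloisGroup (RatFunc L)`, compact Hausdorff totally disconnected and `Λ_L/L(t)` Galois (Mathlib
instances, recorded as theorems; none declared); `CoricPair.ofStableSet K Λ M hM` = the GENUINE-model analogue
of `NFBridgeRecon.coricPairOfSubset` (which lives over the Ex 5.1 (i) INTERFACE): a `Gal(Λ/K)`-stable subset
`M` of an ALGEBRAIC `Λ ⊇ K` with the field multiplication restricted to the pairs whose product stays in `M`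
([IUTchI] §0 p. 33) and the Galois action IS a `CoricPair (Λ ≃ₐ[K] Λ)` — open stabilisers = Mathlib's
`stabilizer_isOpen_of_isIntegral` — and a pseudo-monoid (realised in `Λˣ`) once `0 ∉ M`;
`CriticalLocus.infKappaCoricSetIn S Λ` / `infKappaUnitCoricSetIn S Λ U` = the `∞κ`- and `∞κ×`-coric subsets of
`Λ ⊇ Ω(t)` (`IsInftyKappaCoricIn` / `IsInftyKappaUnitCoricIn`), Galois-stable, `0 ∉`, `1 ∈`;
`infKappaCoricPairIn S Λ` / `infKappaUnitCoricPairIn S Λ U` = the pairs `Gal(Λ/Ω(t)) ↷ 𝕄_{∞κ}`, `↷ 𝕄_{∞κ×}` for ANY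
algebraic `Λ ⊇ Ω(t)` (transports to other algebraic closures / reconstructed presentations reuse them), with
the sub-structure `infKappaCoricSubOfUnit S Λ U` (shape of `InfKappaLink.locInfk`); **`CriticalLocus.infKappaCoricPair
S : CoricPair (RatGal L)`** for `S : CriticalLocus L` — row D1's `G_L^{rat} ↷ 𝕄_{∞κ}(Λ_L)` (shape of
`InfKappaLink.globInfk`) — and `infKappaUnitCoricPair S U`; the printed "`𝕄_κ` = the `π₁^{rat}`-invariants of
`𝕄_{∞κ}`" AT THIS PAIR (`infKappaCoricPair_fixed_iff`, from abc-iut's `isInftyKappaCoricIn_and_fixed_iff`).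

Deliberately NOT here (other gap-B rows): the local completions `K_v` and the t4 `CoricKit` knit (D2/GB-02), the
base-change square `ι_v : Λ_{F̄} → Λ_v` and `ratHom_v` with its continuity (D3/GB-03), clause (a) in its
GEOMETRIC typing and the naive-typing negative (R1), the link `InitialThetaData.infKappaLinkArith` (D4) and
`Ex54ivInfKappaCompat` (D5), the named `CurveModel` and the [AbsTopIII] Thm 1.9 instance binder (D7–D9, C2).
No instance, no notation, no axiom, no `sorry`; definitions + proved elementary theorems only.  Honest scope:
this is print's MODEL presentation of `π₁^{rat}(†𝒟^⊛) ↷ †𝕄^⊛_∞κ` (Ex 5.1 (i) DEFINES `†𝕄^⊛_∞κ` as the [AbsTopIII]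
Thm 1.9 output — the reconstruction presentation / instance binder is C2, not this file).  MODEL-FIDELITY label:
divisors are counted IN `L` (`Ω = L`), so at `L = F̄` (geometric divisors, R1) `RatGal F̄ = Gal(Λ/F̄(t))` is the
GEOMETRIC part of print's `π₁^{rat} = Gal(Λ/F_mod(t))`; the arithmetic group acts on the same carrier through
`CoricPair.ofStableSet (RatFunc F_mod) Λ …` once `G_{F_mod}`-stability of the coric set is supplied (not here).
typed ≠ proved ≠ tokened; nothing here asserts that abc is proved or refuted.
-/

namespace Literature.IUT.HodgeTheaters

open Polynomial
open scoped RatFunc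

universe u v

/-! ### `Λ_L := \overline{L(t)}` and `G_L^{rat} := Gal(Λ_L / L(t))` -/

/-- `Λ_L`: an algebraic closure of the rational function field `L(t) = L_C` (the function field of
`|C_L| ≅ 𝔸¹_L`, [IUTchI] Rmk 3.1.7 (i): "`L_C`", "`L̄_C`"), namely Mathlib's `AlgebraicClosure (RatFunc L)`.
([IUTchI] Rmk 3.1.7 (ii) p.67) [claim: Mochizuki2012, status: disputed] -/
abbrev RatAlgClosure (L : Type u) [Field L] : Type u := AlgebraicClosure (RatFunc L)

/-- `G_L^{rat} := Gal(Λ_L / L(t))`, the MODEL of "`π₁^{rat}(†𝒟^⊛)` … the absolute Galois group of the function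
field of `C_{F_mod}`" (global, `L = F_mod`) resp. of `π₁^{rat}(‡𝒟_v)` (local, `L = K_v`, Def 5.2 (v)), as the group of
`L(t)`-algebra automorphisms of `Λ_L` with Mathlib's Krull topology (an instance of Mathlib; none is declared here).
([IUTchI] Ex 5.1 (i) p.124) [claim: Mochizuki2012, status: disputed] -/
abbrev RatGal (L : Type u) [Field L] : Type u := RatAlgClosure L ≃ₐ[RatFunc L] RatAlgClosure L

section RatGalFacts

variable (L : Type u) [Field L]

/-- `G_L^{rat}` IS Mathlib's absolute Galois group of `L(t)` (definitionally).
([IUTchI] Ex 5.1 (i) p.124) [claim: Mochizuki2012, status: disputed] -/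
theorem ratGal_eq_absoluteGaloisGroup : RatGal L = Field.absoluteGaloisGroup (RatFunc L) := rfl

/-- `G_L^{rat}` is Hausdorff (Mathlib `krullTopology_t2`, algebraic extension).
([IUTchI] Ex 5.1 (i) p.124) [claim: Mochizuki2012, status: disputed] -/
theorem t2Space_ratGal : T2Space (RatGal L) := inferInstance

/-- `G_L^{rat}` is totally disconnected (Mathlib, algebraic extension) — with compactness below: profinite.
([IUTchI] Ex 5.1 (i) p.124) [claim: Mochizuki2012, status: disputed] -/
theorem totallyDisconnectedSpace_ratGal : TotallyDisconnectedSpace (RatGal L) := inferInstance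

variable [CharZero L]

/-- In characteristic `0`, `Λ_L / L(t)` is Galois (perfect base; abc-iut-L5's `isGalois_algebraicClosure_ratFunc`,
here found by instance resolution through `IsSepClosure`). ([IUTchI] Rmk 3.1.7 (ii) p.67)
[claim: Mochizuki2012, status: disputed] -/
theorem isGalois_ratAlgClosure : IsGalois (RatFunc L) (RatAlgClosure L) := inferInstance

/-- `G_L^{rat}` is compact for the Krull topology (Mathlib: Galois ⇒ profinite).
([IUTchI] Ex 5.1 (i) p.124) [claim: Mochizuki2012, status: disputed] -/
theorem compactSpace_ratGal : CompactSpace (RatGal L) := inferInstance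

/-- Galois descent in `Λ_L`: an element fixed by all of `G_L^{rat}` is a rational function (Mathlib
`InfiniteGalois.mem_range_algebraMap_iff_fixed`). ([IUTchI] Ex 5.1 (i) p.124) [claim: Mochizuki2012, status: disputed] -/
theorem mem_range_algebraMap_ratAlgClosure_iff_fixed (x : RatAlgClosure L) :
    x ∈ Set.range (algebraMap (RatFunc L) (RatAlgClosure L)) ↔ ∀ σ : RatGal L, σ x = x :=
  InfiniteGalois.mem_range_algebraMap_iff_fixed x

end RatGalFacts

/-! ### A Galois-stable subset of an algebraic extension as a `CoricPair` over the Galois group -/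

namespace CoricPair

variable (K : Type u) (Λ : Type v) [Field K] [Field Λ] [Algebra K Λ]

/-- The GENUINE-model constructor (companion of `NFBridgeRecon.coricPairOfSubset`, which lives over the Ex 5.1 (i)
interface): a `Gal(Λ/K)`-stable subset `M` of an ALGEBRAIC extension `Λ ⊇ K` as "a pair consisting of a
pseudo-monoid equipped with a continuous action by" `Gal(Λ/K)` — carrier `M`, partial multiplication = the field
multiplication restricted to the pairs whose product stays in `M` ([IUTchI] §0 p. 33), action = the Galois
action, open stabilisers by Mathlib's `stabilizer_isOpen_of_isIntegral` (Krull topology).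
([IUTchI] Ex 5.1 (v) p.127) [claim: Mochizuki2012, status: disputed] -/
abbrev ofStableSet [Algebra.IsIntegral K Λ] (M : Set Λ)
    (hM : ∀ (σ : Λ ≃ₐ[K] Λ) {x : Λ}, x ∈ M → σ • x ∈ M) : CoricPair (Λ ≃ₐ[K] Λ) where
  carrier := (⟨M, fun σ _ hx => hM σ hx⟩ : SubMulAction (Λ ≃ₐ[K] Λ) Λ)
  pm :=
    { dom := {p | (p.1 : Λ) * p.2 ∈ M}
      op := fun p => ⟨(p.1.1 : Λ) * p.1.2, p.2⟩ }
  isOpen_stabilizer x := by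
    rw [SubMulAction.stabilizer_of_subMul]
    exact stabilizer_isOpen_of_isIntegral (x : Λ)
  smul_dom σ p := by
    change (p.1 : Λ) * p.2 ∈ M ↔ (σ • (p.1 : Λ)) * (σ • (p.2 : Λ)) ∈ M
    rw [← smul_mul']
    exact ⟨fun h => hM σ h, fun h => by simpa using hM σ⁻¹ h⟩
  smul_op σ p := Subtype.ext (smul_mul' σ (p.1.1 : Λ) p.1.2)

variable {K Λ}

/-- The action of `ofStableSet` is the Galois action on `Λ`. ([IUTchI] Ex 5.1 (v) p.127)
[claim: Mochizuki2012, status: disputed] -/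
@[simp] theorem coe_smul_ofStableSet [Algebra.IsIntegral K Λ] {M : Set Λ}
    {hM : ∀ (σ : Λ ≃ₐ[K] Λ) {x : Λ}, x ∈ M → σ • x ∈ M} (σ : Λ ≃ₐ[K] Λ)
    (x : (ofStableSet K Λ M hM).carrier) :
    ((σ • x : (ofStableSet K Λ M hM).carrier) : Λ) = σ (x : Λ) := rfl

/-- The domain of the partial multiplication of `ofStableSet`: the pairs whose product stays in `M`.
([IUTchI] Ex 5.1 (v) p.127) [claim: Mochizuki2012, status: disputed] -/
theorem mem_dom_ofStableSet_iff [Algebra.IsIntegral K Λ] {M : Set Λ}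
    {hM : ∀ (σ : Λ ≃ₐ[K] Λ) {x : Λ}, x ∈ M → σ • x ∈ M}
    (p : (ofStableSet K Λ M hM).carrier × (ofStableSet K Λ M hM).carrier) :
    p ∈ (ofStableSet K Λ M hM).pm.dom ↔ (p.1 : Λ) * p.2 ∈ M := Iff.rfl

/-- The partial multiplication of `ofStableSet` is the field multiplication. ([IUTchI] Ex 5.1 (v) p.127)
[claim: Mochizuki2012, status: disputed] -/
@[simp] theorem coe_op_ofStableSet [Algebra.IsIntegral K Λ] {M : Set Λ}
    {hM : ∀ (σ : Λ ≃ₐ[K] Λ) {x : Λ}, x ∈ M → σ • x ∈ M} (p : (ofStableSet K Λ M hM).pm.dom) :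
    ((ofStableSet K Λ M hM).pm.op p : Λ) = (p.1.1 : Λ) * p.1.2 := rfl

/-- Such a pair IS a pseudo-monoid in the sense of [IUTchI] §0 p. 33 (realised in the multiplicative group `Λˣ`
by the inclusion), provided `0 ∉ M`. ([IUTchI] Ex 5.1 (v) p.127) [claim: Mochizuki2012, status: disputed] -/
theorem isPseudoMonoid_ofStableSet [Algebra.IsIntegral K Λ] {M : Set Λ}
    (hM : ∀ (σ : Λ ≃ₐ[K] Λ) {x : Λ}, x ∈ M → σ • x ∈ M) (h0 : (0 : Λ) ∉ M) :
    (ofStableSet K Λ M hM).pm.IsPseudoMonoid := by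
  classical
  have hne : ∀ x : (ofStableSet K Λ M hM).carrier, (x : Λ) ≠ 0 := by
    intro x hx
    exact h0 (hx ▸ x.2)
  refine ⟨Λˣ, inferInstance, fun x => Units.mk0 (x : Λ) (hne x), ⟨?_, ?_, ?_⟩⟩
  · intro x y hxy
    apply Subtype.ext
    simpa [Units.mk0] using congrArg (fun u : Λˣ => (u : Λ)) hxy
  · ext p
    change (p.1 : Λ) * p.2 ∈ M ↔ _
    constructor
    · intro hp
      refine ⟨⟨(p.1 : Λ) * p.2, hp⟩, Units.ext ?_⟩
      simp
    · rintro ⟨z, hz⟩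
      have hz' := congrArg (fun u : Λˣ => (u : Λ)) hz
      simp only [Units.val_mk0, Units.val_mul] at hz'
      rw [← hz']
      exact z.2
  · intro p
    exact Units.ext (by simp)

/-- The `Gal(Λ/K)`-FIXED elements of the pair are exactly those of its elements that lie in (the image of) `K`,
for `Λ/K` Galois (Mathlib `InfiniteGalois.mem_range_algebraMap_iff_fixed`). ([IUTchI] Ex 5.1 (i) p.124)
[claim: Mochizuki2012, status: disputed] -/
theorem forall_smul_eq_iff_ofStableSet [Algebra.IsIntegral K Λ] [IsGalois K Λ] {M : Set Λ}
    {hM : ∀ (σ : Λ ≃ₐ[K] Λ) {x : Λ}, x ∈ M → σ • x ∈ M} (x : (ofStableSet K Λ M hM).carrier) :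
    (∀ σ : Λ ≃ₐ[K] Λ, σ • x = x) ↔ (x : Λ) ∈ Set.range (algebraMap K Λ) := by
  rw [InfiniteGalois.mem_range_algebraMap_iff_fixed]
  refine ⟨fun h σ => ?_, fun h σ => Subtype.ext (h σ)⟩
  exact congrArg Subtype.val (h σ)

end CoricPair

/-! ### The `∞κ`- and `∞κ×`-coric subsets of `Λ ⊇ Ω(t)` and the model pairs -/

namespace CriticalLocus

variable {Ω : Type u} [Field Ω] [CharZero Ω] (S : CriticalLocus Ω) (Λ : Type v) [Field Λ]
  [Algebra (RatFunc Ω) Λ]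

/-- `𝕄_{∞κ}(Λ) ⊆ Λ`: the `∞κ`-coric elements of `Λ ⊇ Ω(t)` (Rmk 3.1.7 (ii): "`f ∈ L̄_C` is `∞κ`-coric if … `fⁿ` is a
`κ`-coric element of `L_C`"), cut out by abc-iut-L5-t2's `IsInftyKappaCoricIn`. ([IUTchI] Rmk 3.1.7 (ii) p.67)
[claim: Mochizuki2012, status: disputed] -/
def infKappaCoricSetIn : Set Λ := {x | S.IsInftyKappaCoricIn Λ x}

/-- `𝕄_{∞κ×}(Λ) ⊆ Λ`: the `∞κ×`-coric elements of `Λ ⊇ Ω(t)` for the unit parameter `U = U_L ⊆ Ω` (Rmk 3.1.7 (ii):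
`U_L = L^×` globally, the units `𝒪_L^×` locally), cut out by `IsInftyKappaUnitCoricIn`. ([IUTchI] Rmk 3.1.7 (ii) p.67)
[claim: Mochizuki2012, status: disputed] -/
def infKappaUnitCoricSetIn (U : Set Ω) : Set Λ := {x | S.IsInftyKappaUnitCoricIn Λ U x}

variable {Λ}

/-- Membership in `𝕄_{∞κ}(Λ)`. ([IUTchI] Rmk 3.1.7 (ii) p.67) [claim: Mochizuki2012, status: disputed] -/
@[simp] theorem mem_infKappaCoricSetIn {x : Λ} :
    x ∈ S.infKappaCoricSetIn Λ ↔ S.IsInftyKappaCoricIn Λ x := Iff.rfl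

/-- Membership in `𝕄_{∞κ×}(Λ)`. ([IUTchI] Rmk 3.1.7 (ii) p.67) [claim: Mochizuki2012, status: disputed] -/
@[simp] theorem mem_infKappaUnitCoricSetIn {U : Set Ω} {x : Λ} :
    x ∈ S.infKappaUnitCoricSetIn Λ U ↔ S.IsInftyKappaUnitCoricIn Λ U x := Iff.rfl

/-- `𝕄_{∞κ}(Λ)` is `Gal(Λ/Ω(t))`-stable (abc-iut's `IsInftyKappaCoricIn.map_algEquiv`: `(σ f)ⁿ = σ(fⁿ) = σ g = g`).
([IUTchI] Ex 5.1 (i) p.124) [claim: Mochizuki2012, status: disputed] -/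
theorem smul_mem_infKappaCoricSetIn (σ : Λ ≃ₐ[RatFunc Ω] Λ) {x : Λ} (hx : x ∈ S.infKappaCoricSetIn Λ) :
    σ • x ∈ S.infKappaCoricSetIn Λ :=
  IsInftyKappaCoricIn.map_algEquiv S Λ hx σ

/-- `𝕄_{∞κ×}(Λ)` is `Gal(Λ/Ω(t))`-stable (the unit multiplier is a constant, fixed by `σ`).
([IUTchI] Ex 5.1 (i) p.124) [claim: Mochizuki2012, status: disputed] -/
theorem smul_mem_infKappaUnitCoricSetIn {U : Set Ω} (σ : Λ ≃ₐ[RatFunc Ω] Λ) {x : Λ}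
    (hx : x ∈ S.infKappaUnitCoricSetIn Λ U) : σ • x ∈ S.infKappaUnitCoricSetIn Λ U :=
  IsInftyKappaUnitCoricIn.map_algEquiv S Λ hx σ

/-- `0` is not `κ`-coric: a `κ`-coric function has no zero at a strictly critical point, and there is one.
([IUTchI] Rmk 3.1.7 (i) p.67) [claim: Mochizuki2012, status: disputed] -/
theorem not_isKappaCoric_zero : ¬ S.IsKappaCoric 0 := by
  intro h
  obtain ⟨e, he⟩ : S.pts.Nonempty := by
    rw [← Finset.card_pos, S.card_eq]; norm_num
  exact h.avoids.num_eval_ne e he (by simp)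

/-- `0 ∉ 𝕄_{∞κ}(Λ)` (`0ⁿ = 0` is the image of `0 ∈ Ω(t)` only, which is not `κ`-coric).
([IUTchI] Rmk 3.1.7 (ii) p.67) [claim: Mochizuki2012, status: disputed] -/
theorem zero_notMem_infKappaCoricSetIn : (0 : Λ) ∉ S.infKappaCoricSetIn Λ := by
  rintro ⟨n, hn, g, hg, h0⟩
  rw [zero_pow hn.ne', eq_comm, map_eq_zero_iff _ (algebraMap (RatFunc Ω) Λ).injective] at h0
  exact S.not_isKappaCoric_zero (h0 ▸ hg)

/-- `0 ∉ 𝕄_{∞κ×}(Λ)`. ([IUTchI] Rmk 3.1.7 (ii) p.67) [claim: Mochizuki2012, status: disputed] -/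
theorem zero_notMem_infKappaUnitCoricSetIn (U : Set Ω) : (0 : Λ) ∉ S.infKappaUnitCoricSetIn Λ U := by
  rintro ⟨c, -, hc⟩
  rw [mul_zero] at hc
  exact S.zero_notMem_infKappaCoricSetIn hc

/-- `1` is `κ`-coric (a constant root of unity: no zeroes, no poles, value `1` at every strictly critical point;
the pole/zero clause only binds non-constants). ([IUTchI] Rmk 3.1.7 (i) p.67) [claim: Mochizuki2012, status: disputed] -/
theorem isKappaCoric_one : S.IsKappaCoric 1 where
  one_pole_two_zeroes h := absurd RatFunc.C.map_one.symm (h 1)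
  divisor_algebraic z hz := by
    simp [zeroes, poles] at hz
  avoids :=
    { num_eval_ne := fun e _ => by simp
      denom_eval_ne := fun e _ => by simp
      natDegree_eq := by simp }
  rootOfUnity_at_critical e _ := ⟨1, one_pos, by simp⟩

/-- `1 ∈ 𝕄_{∞κ}(Λ)`. ([IUTchI] Rmk 3.1.7 (ii) p.67) [claim: Mochizuki2012, status: disputed] -/
theorem one_mem_infKappaCoricSetIn : (1 : Λ) ∈ S.infKappaCoricSetIn Λ :=
  ⟨1, one_pos, 1, S.isKappaCoric_one, by simp⟩

/-- `𝕄_{∞κ}(Λ) ⊆ 𝕄_{∞κ×}(Λ)` as soon as `1 ∈ U` (Def 5.2 (vi): "any `∞κ×`-coric structure … determines an associated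
`∞κ`-coric structure"; `U_L` is a group of units). ([IUTchI] Rmk 3.1.7 (ii) p.67) [claim: Mochizuki2012, status: disputed] -/
theorem infKappaCoricSetIn_subset_infKappaUnitCoricSetIn {U : Set Ω} (hU : (1 : Ω) ∈ U) :
    S.infKappaCoricSetIn Λ ⊆ S.infKappaUnitCoricSetIn Λ U :=
  fun _ hx => ⟨1, hU, by simpa using hx⟩

/-- `1 ∈ 𝕄_{∞κ×}(Λ)` when `1 ∈ U`. ([IUTchI] Rmk 3.1.7 (ii) p.67) [claim: Mochizuki2012, status: disputed] -/
theorem one_mem_infKappaUnitCoricSetIn {U : Set Ω} (hU : (1 : Ω) ∈ U) :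
    (1 : Λ) ∈ S.infKappaUnitCoricSetIn Λ U :=
  S.infKappaCoricSetIn_subset_infKappaUnitCoricSetIn hU S.one_mem_infKappaCoricSetIn

variable (Λ)

/-- `𝕄_{∞κ}(Λ)` as a sub-`Gal(Λ/Ω(t))`-set of `Λ`. ([IUTchI] Ex 5.1 (i) p.124) [claim: Mochizuki2012, status: disputed] -/
def infKappaCoricSubMulAction : SubMulAction (Λ ≃ₐ[RatFunc Ω] Λ) Λ where
  carrier := S.infKappaCoricSetIn Λ
  smul_mem' σ _ hx := S.smul_mem_infKappaCoricSetIn σ hx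

/-- `𝕄_{∞κ×}(Λ)` as a sub-`Gal(Λ/Ω(t))`-set of `Λ`. ([IUTchI] Ex 5.1 (i) p.124) [claim: Mochizuki2012, status: disputed] -/
def infKappaUnitCoricSubMulAction (U : Set Ω) : SubMulAction (Λ ≃ₐ[RatFunc Ω] Λ) Λ where
  carrier := S.infKappaUnitCoricSetIn Λ U
  smul_mem' σ _ hx := S.smul_mem_infKappaUnitCoricSetIn σ hx

/-- **The model `∞κ`-pair over a general algebraic `Λ ⊇ Ω(t)`**: `Gal(Λ/Ω(t)) ↷ 𝕄_{∞κ}(Λ)` as abc-iut-L5-t1's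
`CoricPair` ("the pair `π₁^{rat}(†𝒟^⊛) ↷ 𝕄^⊛_∞κ(†𝒟^⊚)` of (i)", at the model `L̄_C = Λ`).
([IUTchI] Ex 5.1 (v) p.127) [claim: Mochizuki2012, status: disputed] -/
noncomputable abbrev infKappaCoricPairIn [Algebra.IsIntegral (RatFunc Ω) Λ] : CoricPair (Λ ≃ₐ[RatFunc Ω] Λ) :=
  CoricPair.ofStableSet (RatFunc Ω) Λ (S.infKappaCoricSetIn Λ) (fun σ _ hx => S.smul_mem_infKappaCoricSetIn σ hx)

/-- **The model `∞κ×`-pair over a general algebraic `Λ ⊇ Ω(t)`**: `Gal(Λ/Ω(t)) ↷ 𝕄_{∞κ×}(Λ)` (unit parameter `U`).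
([IUTchI] Ex 5.1 (v) p.127) [claim: Mochizuki2012, status: disputed] -/
noncomputable abbrev infKappaUnitCoricPairIn [Algebra.IsIntegral (RatFunc Ω) Λ] (U : Set Ω) :
    CoricPair (Λ ≃ₐ[RatFunc Ω] Λ) :=
  CoricPair.ofStableSet (RatFunc Ω) Λ (S.infKappaUnitCoricSetIn Λ U)
    (fun σ _ hx => S.smul_mem_infKappaUnitCoricSetIn σ hx)

/-- The `∞κ`-coric SUB-structure `𝕄_{∞κ} ⊆ 𝕄_{∞κ×}` inside the `∞κ×`-pair, as a `Gal(Λ/Ω(t))`-stable subset of its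
carrier (the shape of `InfKappaLink.locInfk`; Def 5.2 (vi) p. 137 display). ([IUTchI] Ex 5.1 (v) p.128)
[claim: Mochizuki2012, status: disputed] -/
def infKappaCoricSubOfUnit [Algebra.IsIntegral (RatFunc Ω) Λ] (U : Set Ω) :
    SubMulAction (Λ ≃ₐ[RatFunc Ω] Λ) (S.infKappaUnitCoricPairIn Λ U).carrier where
  carrier := {x | (x : Λ) ∈ S.infKappaCoricSetIn Λ}
  smul_mem' σ _ hx := S.smul_mem_infKappaCoricSetIn σ hx

variable {Λ}

/-- Membership in the `∞κ`-coric sub-structure of the `∞κ×`-pair. ([IUTchI] Ex 5.1 (v) p.128)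
[claim: Mochizuki2012, status: disputed] -/
@[simp] theorem mem_infKappaCoricSubOfUnit_iff [Algebra.IsIntegral (RatFunc Ω) Λ] {U : Set Ω}
    (x : (S.infKappaUnitCoricPairIn Λ U).carrier) :
    x ∈ S.infKappaCoricSubOfUnit Λ U ↔ S.IsInftyKappaCoricIn Λ (x : Λ) := Iff.rfl

/-- The `∞κ`-pair is a pseudo-monoid ([IUTchI] §0 p. 33), realised in `Λˣ`. ([IUTchI] Ex 5.1 (v) p.127)
[claim: Mochizuki2012, status: disputed] -/
theorem isPseudoMonoid_infKappaCoricPairIn [Algebra.IsIntegral (RatFunc Ω) Λ] :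
    (S.infKappaCoricPairIn Λ).pm.IsPseudoMonoid :=
  CoricPair.isPseudoMonoid_ofStableSet _ S.zero_notMem_infKappaCoricSetIn

/-- The `∞κ×`-pair is a pseudo-monoid ([IUTchI] §0 p. 33), realised in `Λˣ`. ([IUTchI] Ex 5.1 (v) p.127)
[claim: Mochizuki2012, status: disputed] -/
theorem isPseudoMonoid_infKappaUnitCoricPairIn [Algebra.IsIntegral (RatFunc Ω) Λ] (U : Set Ω) :
    (S.infKappaUnitCoricPairIn Λ U).pm.IsPseudoMonoid :=
  CoricPair.isPseudoMonoid_ofStableSet _ (S.zero_notMem_infKappaUnitCoricSetIn U)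

/-- "`𝕄^⊛_κ` may be identified with the subset of `π₁^{rat}`-invariants of `𝕄^⊛_∞κ`" AT THE PAIR: an element of the
`∞κ`-pair is fixed by all of `Gal(Λ/Ω(t))` iff it is (the image of) a `κ`-coric rational function (`Λ/Ω(t)`
Galois; abc-iut's `isInftyKappaCoricIn_and_fixed_iff`). ([IUTchI] Ex 5.1 (i) p.124) [claim: Mochizuki2012, status: disputed] -/
theorem infKappaCoricPairIn_fixed_iff [Algebra.IsIntegral (RatFunc Ω) Λ] [IsGalois (RatFunc Ω) Λ]
    (x : (S.infKappaCoricPairIn Λ).carrier) :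
    (∀ σ : Λ ≃ₐ[RatFunc Ω] Λ, σ • x = x) ↔
      ∃ g : RatFunc Ω, S.IsKappaCoric g ∧ algebraMap (RatFunc Ω) Λ g = x := by
  rw [← S.isInftyKappaCoricIn_and_fixed_iff Λ (x : Λ)]
  refine ⟨fun h => ⟨x.2, fun σ => congrArg Subtype.val (h σ)⟩, fun h σ => Subtype.ext (h.2 σ)⟩

/-! ### Row D1: the pairs over `Λ_L` with its absolute Galois group `G_L^{rat}` -/

variable {L : Type u} [Field L] [CharZero L] (T : CriticalLocus L)

/-- **`G_L^{rat} ↷ 𝕄_{∞κ}(Λ_L)`** — the `∞κ`-coric pseudo-monoid of `Λ_L = \overline{L(t)}` with its continuous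
`G_L^{rat}`-action, as abc-iut-L5-t1's t1 `CoricPair (RatGal L)` (the shape of `InfKappaLink.globInfk`; print's MODEL
presentation of `π₁^{rat}(†𝒟^⊛) ↷ †𝕄^⊛_∞κ`, for `L = F_mod` / `F̄`, and of `‡𝕄_{∞κv}` for `L = K_v`).  Row D1 of
GAP-SIZING-B (gap G-L5t9g8-1). ([IUTchI] Ex 5.1 (v) p.127) [claim: Mochizuki2012, status: disputed] -/
noncomputable abbrev infKappaCoricPair : CoricPair (RatGal L) := T.infKappaCoricPairIn (RatAlgClosure L)

/-- **`G_L^{rat} ↷ 𝕄_{∞κ×}(Λ_L)`** — the `∞κ×`-coric pseudo-monoid of `Λ_L` (unit parameter `U = U_L`), as a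
`CoricPair (RatGal L)` (the shape of `InfKappaLink.locInfkx` at `L = K_v`). ([IUTchI] Ex 5.1 (v) p.127)
[claim: Mochizuki2012, status: disputed] -/
noncomputable abbrev infKappaUnitCoricPair (U : Set L) : CoricPair (RatGal L) := T.infKappaUnitCoricPairIn (RatAlgClosure L) U

/-- `G_L^{rat} ↷ 𝕄_{∞κ}(Λ_L)` is a pseudo-monoid ([IUTchI] §0). ([IUTchI] Ex 5.1 (v) p.127)
[claim: Mochizuki2012, status: disputed] -/
theorem isPseudoMonoid_infKappaCoricPair : T.infKappaCoricPair.pm.IsPseudoMonoid :=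
  T.isPseudoMonoid_infKappaCoricPairIn

/-- `G_L^{rat} ↷ 𝕄_{∞κ×}(Λ_L)` is a pseudo-monoid ([IUTchI] §0). ([IUTchI] Ex 5.1 (v) p.127)
[claim: Mochizuki2012, status: disputed] -/
theorem isPseudoMonoid_infKappaUnitCoricPair (U : Set L) : (T.infKappaUnitCoricPair U).pm.IsPseudoMonoid :=
  T.isPseudoMonoid_infKappaUnitCoricPairIn U

/-- `𝕄_κ = (𝕄_{∞κ})^{G_L^{rat}}` at `Λ_L`: the `G_L^{rat}`-fixed elements of the `∞κ`-pair are exactly the `κ`-coric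
rational functions `∈ L(t)` (Galois descent in `Λ_L`, characteristic `0`). ([IUTchI] Ex 5.1 (i) p.124)
[claim: Mochizuki2012, status: disputed] -/
theorem infKappaCoricPair_fixed_iff (x : T.infKappaCoricPair.carrier) :
    (∀ σ : RatGal L, σ • x = x) ↔
      ∃ g : RatFunc L, T.IsKappaCoric g ∧ algebraMap (RatFunc L) (RatAlgClosure L) g = x :=
  T.infKappaCoricPairIn_fixed_iff x

end CriticalLocus

end Literature.IUT.HodgeTheaters
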